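import Literature.AlgebraicGeometry.VanGeemen1994.WeilDiscriminantOfHyperbolic
import Literature.AlgebraicGeometry.HodgeTheory.HodgeRiemannDegreeOneProofs
import Literature.AlgebraicGeometry.Motives.RationalDegreeOneModel
import HarnessLib

/-!
# A `K`-frame of `H¹(A, ℚ)` with its Hermitian Gram determinant, for `(A, φ, h_K)` of ANY dimension `≥ 2` (van Geemen 1994, Lemma 5.2 (2)–(3))

research route conditional on HC_CM; not a corollary; Q11.4-sentence-2 already refuted in dim ≥ 3.
(Cell `pub-hodge-ring2`, seat `ab-weil-2`; companion of `VanGeemen1994/WeilDiscriminantOfHyperbolic`,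
whose existence theorem `exists_hasWeilDiscriminantNondeg` packages the same construction for EVEN
`K`-rank `2n` as a `HasWeilDiscriminantNondeg` witness. Here the construction is exported for an abelian
variety of ANY dimension `m + 1 ≥ 2` — `K`-rank `m + 1`, possibly odd (the threefold factor `X₂` of the
Weil-type products `E_k × X₂`, Moonen–Zarhin 1999 Thm. 0.1 (a)) — together with the top self-intersection
coefficient of `h_K`. Theorems only; no definition, no named fact.)

Source (held): B. van Geemen, LNM 1594 (1994), 5.2–5.3: `V = H₁(X, ℚ)` is a `K`-vector space, the
polarization gives "a non-degenerate Hermitian form on the `K`-vectorspace" with matrix `Ψ` in "some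
`K`-basis", `det Ψ ∈ ℚ^*` (Lemma 5.2 (2)–(3)); nothing in (2)–(3) uses the parity of `dim_K V`.

* `exists_kFrame_ksymm` — for `dim A = m + 1 ≥ 2`, `φ ≫ φ = -d` (`d ≥ 1`), `e`, rational `a ≠ 0`,
  `h_K = d·e^*a + φ^*e^*a`: rational classes `x₁, …, x_{m+1} ∈ H¹(A(ℂ); ℂ)` with `{xᵢ, φ^*xᵢ}`
  `ℂ`-independent, a non-zero rational top class `ω`, rational `a, b` with `Q_{h_K}(xᵢ, φ^*xⱼ) = aᵢⱼ ω`,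
  `Q_{h_K}(xᵢ, xⱼ) = bᵢⱼ ω`, `det(a + b√-d) = q ∈ ℚˣ`, and `h_K^{m+1} = t·ω` with `t ∈ ℚ`.

## References

* [vanGeemen1994HodgeAV] B. van Geemen, LNM 1594 (1994), 4.8–4.9, Lemma 5.2 (1)–(3), 5.3.
* [MoonenZarhin1999LowDim] B. Moonen, Yu. Zarhin, Math. Ann. 315 (1999), Thm. 0.1 (a).
-/

noncomputable section

open CategoryTheory Polynomial Module
open scoped Matrix
open Literature.AlgebraicTopology.SingularHomology
open Literature.AlgebraicGeometry.HodgeTheory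
open Literature.AlgebraicGeometry.Motives
open Literature.Geometry.Kaehler

namespace Literature.AlgebraicGeometry.VanGeemen1994

variable {m d : ℕ} {A : AbelianVariety ℂ} {φ : A ⟶ A}

/-- **A `K`-frame of `H¹(A, ℚ)` with its Gram determinant and top coefficient, any dimension `≥ 2`**
(van Geemen Lemma 5.2 (2)–(3) on the carriers; the construction of
`VanGeemen1994.exists_hasWeilDiscriminantNondeg`, `K`-rank `m + 1` not necessarily even). For
`dim A = m + 1`, `m ≥ 1`, `φ ≫ φ = -(d • 𝟙 A)` (`d ≥ 1`), a projective embedding `e` and a rational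
`a ≠ 0`, with `h_K = d·e^*a + φ^*e^*a`: there are rational `x : Fin (m+1) → H¹(A(ℂ); ℂ)` with
`{xᵢ, φ^* xᵢ}` `ℂ`-linearly independent (a `K_d`-basis of `H¹(A, ℚ)`), a non-zero rational
`ω ∈ H^{2m+2}`, rational matrices `a`, `b` with `Q_{h_K, m}(xᵢ, φ^* xⱼ) = aᵢⱼ · ω`,
`Q_{h_K, m}(xᵢ, xⱼ) = bᵢⱼ · ω`, a unit `q ∈ ℚˣ` with `det(a + b√-d) = q` in `K_d` (the Hermitian Gram
determinant — non-zero by the non-degeneracy of the rational Riemann form of `h_K`), and `t ∈ ℚ` with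
`h_K^{m+1} = L_{h_K}^m h_K = t · ω`. [cite: vanGeemen1994HodgeAV, Lemma 5.2 (1)–(3) and 5.3]
[cite: MoonenZarhin1999LowDim, Thm. 0.1 (a)] -/
theorem exists_kFrame_ksymm (hm : 1 ≤ m) (hA : A.dim = m + 1) (hd : 0 < d) (hφ : φ ≫ φ = -(d • 𝟙 A))
    (e : ProjectiveEmbedding A.X) {a : complexBetti (projectiveSpace e.n ℂ) 2} (ha : IsRationalClass a)
    (ha0 : a ≠ 0) :
    ∃ (x : Fin (m + 1) → complexBetti A.X 1) (ω : complexBetti A.X (2 + 2 * m))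
      (am bm : Matrix (Fin (m + 1)) (Fin (m + 1)) ℚ) (q : ℚˣ) (t : ℚ),
      (∀ i, IsRationalClass (x i)) ∧
      LinearIndependent ℂ (Sum.elim x (fun i => complexBetti.map φ.hom.hom.hom 1 (x i))) ∧
      IsRationalClass ω ∧ ω ≠ 0 ∧
      (∀ i j, polarizationPairingOne A.X
          ((d : ℂ) • complexBetti.map e.ι 2 a + complexBetti.map φ.hom.hom.hom 2 (complexBetti.map e.ι 2 a)) m
          (x i) (complexBetti.map φ.hom.hom.hom 1 (x j)) = ((am i j : ℚ) : ℂ) • ω ∧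
        polarizationPairingOne A.X
          ((d : ℂ) • complexBetti.map e.ι 2 a + complexBetti.map φ.hom.hom.hom 2 (complexBetti.map e.ι 2 a)) m
          (x i) (x j) = ((bm i j : ℚ) : ℂ) • ω) ∧
      (weilGramMatrix d am bm).det = algebraMap ℚ (weilField d) (q : ℚ) ∧
      lefschetzPow ((d : ℂ) • complexBetti.map e.ι 2 a + complexBetti.map φ.hom.hom.hom 2 (complexBetti.map e.ι 2 a)) m 2
        ((d : ℂ) • complexBetti.map e.ι 2 a + complexBetti.map φ.hom.hom.hom 2 (complexBetti.map e.ι 2 a)) =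
        ((t : ℚ) : ℂ) • ω := by
  classical
  have hX : IsSmoothProjective (m + 1) A.X := Motives.isSmoothProjective_of_dim_eq' hA
  set hK := (d : ℂ) • complexBetti.map e.ι 2 a + complexBetti.map φ.hom.hom.hom 2 (complexBetti.map e.ι 2 a)
    with hKdef
  have hhK : IsRationalClass hK := isRationalClass_ksymm d φ e ha
  -- a rational generator of the top line
  have h1 := Motives.finrank_complexBetti_two_add_two_mul_eq_one hX
  obtain ⟨ω₀, hω, hω0⟩ := Motives.exists_isRationalClass_ne_zero_two_add_two_mul hX
  -- the top coefficient
  obtain ⟨t, ht⟩ := Motives.exists_eq_ratCast_smul_of_finrank_eq_one h1 hω hω0 (HodgeRiemannDegreeOne.IsRationalClass.lefschetzPow hhK m hhK)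
  -- the rational Weil datum
  let D : WeilDatum ↥(bettiCohomology A.X 1) := weilDatumOfKsymm hm hA hd hφ e ha ha0 hω hω0
  haveI : Module.Finite ℚ ↥(bettiCohomology A.X 1) := finite_bettiCohomology_one A
  have hV : Module.finrank ℚ ↥(bettiCohomology A.X 1) = 2 * (m + 1) := by
    rw [finrank_bettiCohomology_one, hA]
  -- `K_d`, `α`, `σ`
  haveI : Fact (Irreducible (X ^ 2 + C (d : ℚ) : ℚ[X])) := ⟨irreducible_X_sq_add_C hd⟩
  have hdQ : (0 : ℚ) < d := by exact_mod_cast hd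
  have hα : weilSqrt d * weilSqrt d = algebraMap ℚ (weilField d) (-(d : ℚ)) :=
    weilSqrt_mul_self_eq_algebraMap d
  have hKspan : ∀ k : weilField d, ∃ p q : ℚ,
      k = algebraMap ℚ (weilField d) p + algebraMap ℚ (weilField d) q * weilSqrt d :=
    exists_eq_algebraMap_add_mul_weilSqrt d
  obtain ⟨σ, hσα⟩ := exists_ringHom_weilSqrt_eq_neg d
  -- `H¹(A, ℚ)` as a `K_d`-space
  obtain ⟨instM, hinst⟩ := exists_module_smul_eq hdQ hα hKspan D.α D.α_α
  letI : Module (weilField d) ↥(bettiCohomology A.X 1) := instM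
  obtain ⟨instT, hαJ⟩ := hinst
  haveI : IsScalarTower ℚ (weilField d) ↥(bettiCohomology A.X 1) := instT
  haveI : Module.Finite (weilField d) ↥(bettiCohomology A.X 1) :=
    Module.Finite.of_restrictScalars_finite ℚ (weilField d) ↥(bettiCohomology A.X 1)
  have h2fin : 2 * Module.finrank (weilField d) ↥(bettiCohomology A.X 1) =
      Module.finrank ℚ ↥(bettiCohomology A.X 1) :=
    two_mul_finrank_eq_of_weilOperator hdQ hα hKspan
  have hVK : Module.finrank (weilField d) ↥(bettiCohomology A.X 1) = m + 1 := by omega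
  -- the form `E`
  have hE : ∀ x y : ↥(bettiCohomology A.X 1), D.E y x = -D.E x y := D.E_swap
  have hW : ∀ x y : ↥(bettiCohomology A.X 1), D.E (weilSqrt d • x) (weilSqrt d • y) = (d : ℚ) * D.E x y :=
    fun x y => by rw [hαJ, hαJ]; exact D.E_α x y
  have hN : D.E.Nondegenerate := D.E_nondegenerate
  -- a `K`-basis `β` and its Gram determinant
  let β : Basis (Fin (m + 1)) (weilField d) ↥(bettiCohomology A.X 1) :=
    Module.finBasisOfFinrankEq (weilField d) ↥(bettiCohomology A.X 1) hVK
  obtain ⟨u, hu⟩ := exists_units_algebraMap_eq_det_gramMatrix D.E σ hdQ hα hE hW hN hσα hKspan β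
  -- the carrier frame
  let x : Fin (m + 1) → complexBetti A.X 1 := fun i => ofRatClass (ComplexPoints A.X) 1 (β i)
  have hxrat : ∀ i, IsRationalClass (x i) := fun i => isRationalClass_ofRatClass _
  have hφβ : ∀ v : ↥(bettiCohomology A.X 1),
      complexBetti.map φ.hom.hom.hom 1 (ofRatClass (ComplexPoints A.X) 1 v) =
        ofRatClass (ComplexPoints A.X) 1 (weilSqrt d • v) := fun v => by
    rw [hαJ]
    exact (ofRatClass_bettiMap φ.hom.hom.hom v).symm
  have hQ : ∀ v w : ↥(bettiCohomology A.X 1),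
      polarizationPairingOne A.X hK m (ofRatClass (ComplexPoints A.X) 1 v)
          (ofRatClass (ComplexPoints A.X) 1 w) = ((D.E v w : ℚ) : ℂ) • ω₀ := fun v w => by
    have hs : ((D.E v w : ℚ) : ℂ) = lineCoord ω₀ hω0 h1 (polarizationPairingOne A.X hK m
        (ofRatClass (ComplexPoints A.X) 1 v) (ofRatClass (ComplexPoints A.X) 1 w)) :=
      ratPolarizationForm_spec hK hhK m (lineCoord ω₀ hω0 h1) (lineCoord_ratValued _ hω hω0) v w
    rw [hs, lineCoord_smul_self]
  have hind : LinearIndependent ℂ (Sum.elim x (fun i => complexBetti.map φ.hom.hom.hom 1 (x i))) := by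
    let bK : Basis (Fin 2) ℚ (weilField d) := basisOneAlpha hdQ hα hKspan
    let bV : Basis (Fin 2 × Fin (m + 1)) ℚ ↥(bettiCohomology A.X 1) := bK.smulTower β
    have bV_apply : ∀ p : Fin 2 × Fin (m + 1), bV p = bK p.1 • β p.2 := fun p =>
      Basis.smulTower_apply bK β p
    have bK0 : bK 0 = 1 := basisOneAlpha_apply_zero hdQ hα hKspan
    have bK1 : bK 1 = weilSqrt d := basisOneAlpha_apply_one hdQ hα hKspan
    let ε : Fin (m + 1) ⊕ Fin (m + 1) → Fin 2 × Fin (m + 1) :=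
      Sum.elim (fun i => ((0 : Fin 2), i)) (fun i => ((1 : Fin 2), i))
    have hε : Function.Injective ε := by
      rintro (i | i) (j | j) h
      · simp only [ε, Sum.elim_inl, Prod.mk.injEq] at h
        rw [h.2]
      · simp only [ε, Sum.elim_inl, Sum.elim_inr, Prod.mk.injEq] at h
        exact absurd h.1 (by decide)
      · simp only [ε, Sum.elim_inl, Sum.elim_inr, Prod.mk.injEq] at h
        exact absurd h.1 (by decide)
      · simp only [ε, Sum.elim_inr, Prod.mk.injEq] at h
        rw [h.2]
    have hg : LinearIndependent ℚ (bV ∘ ε) := bV.linearIndependent.comp ε hε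
    have hgeq : ∀ s, ofRatClass (ComplexPoints A.X) 1 ((bV ∘ ε) s) =
        Sum.elim x (fun i => complexBetti.map φ.hom.hom.hom 1 (x i)) s := by
      rintro (i | i)
      · show ofRatClass (ComplexPoints A.X) 1 (bV (0, i)) = ofRatClass (ComplexPoints A.X) 1 (β i)
        rw [bV_apply, bK0, one_smul]
      · show ofRatClass (ComplexPoints A.X) 1 (bV (1, i)) =
          complexBetti.map φ.hom.hom.hom 1 (ofRatClass (ComplexPoints A.X) 1 (β i))
        rw [hφβ, bV_apply, bK1]
    have hfun : (fun s => singularCohomology.ringChange (algebraMap ℚ ℂ) (ComplexPoints A.X) 1 ((bV ∘ ε) s)) =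
        Sum.elim x (fun i => complexBetti.map φ.hom.hom.hom 1 (x i)) := by
      funext s
      rw [← ofRatClass_eq_ringChange]
      exact hgeq s
    rw [← hfun]
    exact (linearIndependent_ringChange_iff _).mpr hg
  -- the Gram matrix `Ψ = a + b√-d` of `H` in `β`
  let am : Matrix (Fin (m + 1)) (Fin (m + 1)) ℚ := fun i j => D.E (β i) (weilSqrt d • β j)
  let bm : Matrix (Fin (m + 1)) (Fin (m + 1)) ℚ := fun i j => D.E (β i) (β j)
  have hgram : weilGramMatrix d am bm = gramMatrix (weilHermitianForm D.E (weilSqrt d)) ⇑β := by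
    ext i j
    rw [weilGramMatrix_apply, gramMatrix_apply, weilHermitianForm_apply, mul_comm (weilSqrt d)]
    rfl
  refine ⟨x, ω₀, am, bm, u, t, hxrat, hind, hω, hω0, fun i j => ⟨?_, ?_⟩, ?_, ht⟩
  · show polarizationPairingOne A.X hK m (ofRatClass (ComplexPoints A.X) 1 (β i))
        (complexBetti.map φ.hom.hom.hom 1 (ofRatClass (ComplexPoints A.X) 1 (β j))) =
      ((D.E (β i) (weilSqrt d • β j) : ℚ) : ℂ) • ω₀
    rw [hφβ, hQ]
  · exact hQ (β i) (β j)
  · rw [hgram, ← hu]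
    rfl

end Literature.AlgebraicGeometry.VanGeemen1994

end
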